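import Summits.QuantumFields.YangMills.Theorems.BalabanUVNodesN09RegularOnOfLoopSmallChi29Local
import Summits.QuantumFields.YangMills.Theorems.BalabanUVNodesN09LocalSupportSetAtRecord
import HarnessLib

/-!
# BalabanUVNodes ∕ N09 — THE ANALYTIC INCLUSION `hreg` OF THE N09 DOORS ON THE LOCAL ROUTE (ROAD B) FOR THE RECORD'S OWN β-INPUT, WITH THE LOCAL SUPPORT SET PLUGGED:
# dag-n09-w3 g6's localised door (p636180) and local support set (`…N09LocalSupportSetAtRecord`) assembled — `domAlt_{j+1} ⊆ regSetOfRecord K j ρ_j` from (H-U), (I19), [B11]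
# solvability on the domains, continuity of the critical configuration ON the next domain, continuity of `GF_j`, `A_j` on `domAlt_j`, and NUMERICS only

Cell `pub-ymgap`, width seat `pub-ymgap-dag-n09-w2` generation 5 (HUMAN RULING D-0149; DAG node N09 = [Balaban1987RG1] §§2–5; INBOX INTENT-5 l.37843 ∕ l.38603, dag-n09-w3 g5∕g6's hands
I.37729 ∕ I.37993 ∕ I.38363).  `--kind proof --supports stmt-QuantumFields-27364 --as helper` (K1⁹ `StabilityBRunRowsAtRecordR13SepCoPHV`; count-neutral; theorems only, 0 def ∕ 0 instance ∕
0 notation ∕ 0 sorry).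

WHY.  ROAD B to the analytic inclusion is CLOSED BY NAME for densities cut at the (2.9) thresholds and LOCALISED over the fibres of the next small-field domain (dag-n09-w3 g6
`regularOn_of_loopSmall_chi29_local`, p636180: boundedness, support and continuity of `ρ` asked only on a closed guard set `K₀` and over `Ū⁻¹(D)`), and the same seat's
`…N09LocalSupportSetAtRecord` SUPPLIES, for the record's OWN β-input `ρ_j = χ^{(2.9)}_j·exp[−GF_j∕g_j² + A_j]`, the set `K₀ j = «loops ≤ α ∧ plaquettes ≤ B»` with every binder of
that door: closedness, the loop guard, `K₀ j ⊆ domAlt_j` (strict `B < ε₀`), the localised support clause (from `hsolν` + numerics), `ρ_j ≤ C₀` on `K₀ j` (from `GF_j`, `A_j` continuous on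
`domAlt_j`) and the continuity clause (from the critical configuration continuous ON `domAlt_{j+1}`, via this seat's p632927).  THIS FILE writes the assembly: χ-generically with an
abstract support set (§1) and at the Stage-13 letters with the support set plugged (§2), ending with the doors' binder `hreg` for every step of a run (§3).

CONTENTS.  §1 ★★ `regularOn_betaInput_chi29_of_loopSmall_local` (abstract closed `K₀ ⊆ D_k`, pointwise hcrit on `K₀`), ★★ `regularOn_betaInput_chi29_of_loopSmall_local_of_continuousOn_crit`
(hcrit ON the coarse set `D'`), `domAlt_subset_regSetOfRecord_betaInput_chi29_of_loopSmall_local`.  §2 ★★★ `regularOn_domAlt_betaInputOfRecord_of_localSupportSet` — ONE STEP `j < K` at the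
Stage-13 letters (`chiβOfRecord₁₃ θ₀`, any transport `T`, any history `g`): `domAlt_{j+1} ⊆ regSetOfRecord K j ρ_j ∧ HasContTransportOn K j ρ_j domAlt_{j+1}` from (H-U) `hρm`, (I19)
`hint`, `hsolν`, `hcrit : ContinuousOn (critCfgOfRecord θ₀.ν K j) domAlt_{j+1}`, `GF_j`∕`A_j` continuous on `domAlt_j`, numerics.  §3 ★★★ `hreg_of_localSupportSet` (run `P`,
`TβOfRecord₁₃`, `gOfRecord₁₃ θ₀ P`: the doors' binder `∀ j < P.K, domAltOfRecord θ₀.ν P.K (j+1) ⊆ regSetOfRecord F N P.K j ρ_j` VERBATIM), ★★ `hasContTransportOn_domAlt_of_localSupportSet`,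
★★ `continuousOn_TβOfRecord₁₃_betaInput_domAlt_of_localSupportSet`.

DISPLAYED (never asserted): (H-U) measurability and (I19) integrability of `ρ_j`; [B11] solvability `hsolν` on the domains; `hcrit` = continuity of the critical configuration `W ↦ V^{(j)}(W)`
ON `domAlt_{j+1}` (dag-n09-w1 g6's `hcritSel_…` supplies it for the Sel edition; for the bare `Classical.choose` background NO supplier — dag-n09-w3 g6's crit-parametric CLAIM-3);
`GF_j` continuous on `domAlt_j` (dag-n09-w1 g5's `continuousOn_gfOfRecord_domAlt`, numerics) and `A_j` continuous on `domAlt_j` (the tower's previous step — INTENT-6); numerics: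
`0 < εreg`, [B7] ×2, `0 < ε₂₉`, the rider ×2, `(((d+2)L)²∕4)·B < α ≤ 1∕24`, `α < δ_N`, `157·α < L^{1−d}`, STRICT `B < ε₀`.

HONEST FRAMING.  Assembly BY NAME; NOTHING of Bałaban's asserted; `hreg` RE-SHAPED to the displayed inputs, NOT discharged; N09 NOT discharged; conjunct 1 (Lemma 4) ∕ FLAG №7 untouched;
K0⁷ ∕ K1⁹ ∕ K2⁹ ∕ K3⁸ NOT closed; counts unmoved (typed 28∕28 · discharged 5∕28); no summit statement is proved here; R4 = the conditional finite-𝕋⁴ rung `BalabanLadder.UV` only — NOT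
continuum ∕ ℝ⁴ ∕ OS; the Yang–Mills mass gap (Clay) is NOT proved by any of this.
-/

noncomputable section

open Filter Topology Set Function MeasureTheory

namespace Summit.QuantumFields.YangMills.BalabanUVNodes.N09HregOfLoopSmallChi29AtRecord

open Literature.MathematicalPhysics.QuantumFieldTheory.Balaban1983to89
open Literature.MathematicalPhysics.QuantumFieldTheory.Balaban1983to89.Node00
open Literature.MathematicalPhysics.QuantumFieldTheory.Balaban1983to89.T4Continuum (T4Family)
open Literature.MathematicalPhysics.QuantumFieldTheory.Balaban1983to89.BlockAveraging (Idx loopHol)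
open Literature.MathematicalPhysics.QuantumFieldTheory.Balaban1983to89.BlockAveragingHaarAC (centralBond)
open Literature.MathematicalPhysics.QuantumFieldTheory.Balaban1983to89.ExpMeanLog (deltaSU)
open Literature.MathematicalPhysics.QuantumFieldTheory.Balaban1983to89.B12ContinuousTransportInvarianceOn (isOpen_domAltOfRecord)
open Summit.QuantumFields.YangMills.BalabanUVNodes.N09RegularOnOfLoopSmallChi29Local (regularOn_of_loopSmall_chi29_local)
open Summit.QuantumFields.YangMills.BalabanUVNodes.N09LocalSupportSetAtRecord
open Summit.QuantumFields.YangMills.BalabanUVNodes.N09TransportPositiveOnDomainOfFibredChart (betaInput_chi29_nonneg)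
open Summit.QuantumFields.YangMills.BalabanUVNodes.N09BetaInputContinuousOffChi29Thresholds (hρc_betaInput_chi29_of_hcrit_centralBond)

variable {F : T4Family} {N : ℕ} [NeZero N]

/-! ## §1 χ-generic, abstract support set: the β-input has a regular transform over the fibres of an open coarse set -/

section Generic

variable (ν : Stage7Numerics) {K k : ℕ}

/-- ★★ **THE β-INPUT HAS A REGULAR TRANSFORM OVER THE FIBRES OF AN OPEN COARSE SET `D'` ON THE LOCAL ROUTE** (any transport `T`, history `g`; `ε₁ ≠ 0`, `k < K`):
`D' ⊆ regSetOfRecord F N K k ρ_k ∧ HasContTransportOn F N K k ρ_k D'` — dag-n09-w3 g6's `regularOn_of_loopSmall_chi29_local` with its bound on `K₀` supplied by their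
`hρC_betaInput_chi29_of_continuousOn` (compactness) and its LOCAL continuity clause by this seat's p632927 (pointwise hcrit on `K₀` at the non-central bonds).  Displayed: `ρ_k` measurable and
integrable; a closed `K₀` in the loop α-guard, `K₀ ⊆ D_k` open with `GF_k`, `A_k` continuous on `D_k`; the localised support clause `Ū U ∈ D' → ρ_k U ≠ 0 → U ∈ interior K₀`.
[cite: Balaban1987RG1, (0.13) p.254, (0.19) p.255, (2.9) p.266, (2.10) p.267 and p.259] -/
theorem regularOn_betaInput_chi29_of_loopSmall_local (hk : k < K) {α : ℝ} (hα24 : α ≤ 1 / 24) (hαδ : α < deltaSU (Fin N))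
    (hαL : 157 * α < (((F.P K).L : ℝ) ^ ((F.P K).d - 1))⁻¹) {ε₁ : ℝ} (hε : ε₁ ≠ 0) (T : Transport F N) (g : ℕ → ℝ)
    (hρm : Measurable (betaInputOfRecord F N T (chiFixed29 F N ν ε₁) K g k))
    (hint : Integrable (betaInputOfRecord F N T (chiFixed29 F N ν ε₁) K g k) (fieldMeasure (F.P K) k (SU N)))
    {D' : Set (GaugeField (F.P K) (k + 1) (SU N))} (hD' : IsOpen D')
    {K₀ Dk : Set (GaugeField (F.P K) k (SU N))} (hK₀ : IsClosed K₀) (hDk : IsOpen Dk) (hK₀Dk : K₀ ⊆ Dk)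
    (hK₀α : ∀ U ∈ K₀, ∀ c i, dist1 (loopHol U c i) ≤ α)
    (hρK : ∀ U, (avOfRecord F N K k).avg U ∈ D' → betaInputOfRecord F N T (chiFixed29 F N ν ε₁) K g k U ≠ 0 → U ∈ interior K₀)
    (hcrit : ∀ U ∈ K₀, ∀ b : PBond (F.P K) k, (∀ c : PBond (F.P K) (k + 1), centralBond c ≠ b) →
      ContinuousAt (fun V : GaugeField (F.P K) k (SU N) => critCfgOfRecord F N ν K k ((avOfRecord F N K k).avg V) b) U)
    (hGF : ContinuousOn (gfOfRecord F N K k) Dk) (hA : ContinuousOn (effActionHT F N T (chiFixed29 F N ν ε₁) K g k) Dk) :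
    D' ⊆ regSetOfRecord F N K k (betaInputOfRecord F N T (chiFixed29 F N ν ε₁) K g k) ∧
      HasContTransportOn F N K k (betaInputOfRecord F N T (chiFixed29 F N ν ε₁) K g k) D' :=
  regularOn_of_loopSmall_chi29_local ν hk hα24 hαδ hαL hε hρm hint (betaInput_chi29_nonneg ν ε₁ T K g k) hD' hK₀ hK₀α
    (hρC_betaInput_chi29_of_continuousOn (K := K) ν ε₁ T g k hK₀ hK₀Dk hGF hA) hρK
    (fun U hU _ hne => hρc_betaInput_chi29_of_hcrit_centralBond ν ε₁ T K g k hcrit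
      (fun _ hU' => hGF.continuousAt (hDk.mem_nhds (hK₀Dk hU'))) (fun _ hU' => hA.continuousAt (hDk.mem_nhds (hK₀Dk hU'))) U hU hne)

/-- ★★ **THE SAME WITH `hcrit` IN ITS ON-DOMAIN SHAPE**: the critical configuration `W ↦ V^{(k)}(W)` continuous ON `D'` (dag-n09-w3 g6's `hρc_betaInput_chi29_local_of_continuousOn_crit`
supplies the local continuity clause from it, the averaging being continuous at guard points). [cite: Balaban1987RG1, (0.4) p.253, (2.3) p.265, (2.9) p.266 and p.259] -/
theorem regularOn_betaInput_chi29_of_loopSmall_local_of_continuousOn_crit (hk : k < K) {α : ℝ} (hα24 : α ≤ 1 / 24) (hαδ : α < deltaSU (Fin N))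
    (hαL : 157 * α < (((F.P K).L : ℝ) ^ ((F.P K).d - 1))⁻¹) {ε₁ : ℝ} (hε : ε₁ ≠ 0) (T : Transport F N) (g : ℕ → ℝ)
    (hρm : Measurable (betaInputOfRecord F N T (chiFixed29 F N ν ε₁) K g k))
    (hint : Integrable (betaInputOfRecord F N T (chiFixed29 F N ν ε₁) K g k) (fieldMeasure (F.P K) k (SU N)))
    {D' : Set (GaugeField (F.P K) (k + 1) (SU N))} (hD' : IsOpen D')
    {K₀ Dk : Set (GaugeField (F.P K) k (SU N))} (hK₀ : IsClosed K₀) (hDk : IsOpen Dk) (hK₀Dk : K₀ ⊆ Dk)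
    (hK₀α : ∀ U ∈ K₀, ∀ c (i : Idx (F.P K)), dist1 (loopHol U c i) ≤ α)
    (hρK : ∀ U, (avOfRecord F N K k).avg U ∈ D' → betaInputOfRecord F N T (chiFixed29 F N ν ε₁) K g k U ≠ 0 → U ∈ interior K₀)
    (hcrit : ContinuousOn (critCfgOfRecord F N ν K k) D')
    (hGF : ContinuousOn (gfOfRecord F N K k) Dk) (hA : ContinuousOn (effActionHT F N T (chiFixed29 F N ν ε₁) K g k) Dk) :
    D' ⊆ regSetOfRecord F N K k (betaInputOfRecord F N T (chiFixed29 F N ν ε₁) K g k) ∧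
      HasContTransportOn F N K k (betaInputOfRecord F N T (chiFixed29 F N ν ε₁) K g k) D' :=
  regularOn_of_loopSmall_chi29_local ν hk hα24 hαδ hαL hε hρm hint (betaInput_chi29_nonneg ν ε₁ T K g k) hD' hK₀ hK₀α
    (hρC_betaInput_chi29_of_continuousOn (K := K) ν ε₁ T g k hK₀ hK₀Dk hGF hA) hρK
    (hρc_betaInput_chi29_local_of_continuousOn_crit (K := K) ν ε₁ T g hD' hDk hK₀Dk hαδ hK₀α hcrit hGF hA)

/-- ★★ **THE `hreg` SHAPE FOR THE β-INPUT, LOCALISED** (`D' := domAltOfRecord ν' K (k+1)`, hcrit on-domain). [cite: Balaban1987RG1, p.259, (2.9) p.266 and (2.10) p.267] -/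
theorem domAlt_subset_regSetOfRecord_betaInput_chi29_of_loopSmall_local (ν' : Stage7Numerics) (hk : k < K) {α : ℝ} (hα24 : α ≤ 1 / 24)
    (hαδ : α < deltaSU (Fin N)) (hαL : 157 * α < (((F.P K).L : ℝ) ^ ((F.P K).d - 1))⁻¹) {ε₁ : ℝ} (hε : ε₁ ≠ 0) (T : Transport F N) (g : ℕ → ℝ)
    (hρm : Measurable (betaInputOfRecord F N T (chiFixed29 F N ν ε₁) K g k))
    (hint : Integrable (betaInputOfRecord F N T (chiFixed29 F N ν ε₁) K g k) (fieldMeasure (F.P K) k (SU N)))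
    {K₀ Dk : Set (GaugeField (F.P K) k (SU N))} (hK₀ : IsClosed K₀) (hDk : IsOpen Dk) (hK₀Dk : K₀ ⊆ Dk)
    (hK₀α : ∀ U ∈ K₀, ∀ c (i : Idx (F.P K)), dist1 (loopHol U c i) ≤ α)
    (hρK : ∀ U, (avOfRecord F N K k).avg U ∈ domAltOfRecord F N ν' K (k + 1) →
      betaInputOfRecord F N T (chiFixed29 F N ν ε₁) K g k U ≠ 0 → U ∈ interior K₀)
    (hcrit : ContinuousOn (critCfgOfRecord F N ν K k) (domAltOfRecord F N ν' K (k + 1)))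
    (hGF : ContinuousOn (gfOfRecord F N K k) Dk) (hA : ContinuousOn (effActionHT F N T (chiFixed29 F N ν ε₁) K g k) Dk) :
    domAltOfRecord F N ν' K (k + 1) ⊆ regSetOfRecord F N K k (betaInputOfRecord F N T (chiFixed29 F N ν ε₁) K g k) ∧
      HasContTransportOn F N K k (betaInputOfRecord F N T (chiFixed29 F N ν ε₁) K g k) (domAltOfRecord F N ν' K (k + 1)) :=
  regularOn_betaInput_chi29_of_loopSmall_local_of_continuousOn_crit ν hk hα24 hαδ hαL hε T g hρm hint (isOpen_domAltOfRecord ν' K (k + 1))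
    hK₀ hDk hK₀Dk hK₀α hρK hcrit hGF hA

end Generic

/-! ## §2 At the Stage-13 letters, with dag-n09-w3 g6's local support set plugged: ONE STEP from (H-U), (I19), `hsolν`, on-domain hcrit, `GF_j`∕`A_j` continuity and numerics -/

section Letters

variable (θ₀ : Stage13Params F N) (K : ℕ) (g : ℕ → ℝ)

/-- ★★★ **ONE STEP OF ROAD B AT THE STAGE-13 LETTERS, EVERY SUPPORT BINDER SUPPLIED** (`χ := chiβOfRecord₁₃ θ₀ = chiFixed29 θ₀.ν θ₀.ε₂₉`; ANY transport `T`, ANY history `g`; `j < K`):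
`domAlt_{j+1} ⊆ regSetOfRecord F N K j ρ_j ∧ HasContTransportOn F N K j ρ_j domAlt_{j+1}` for `ρ_j = betaInputOfRecord T (chiβOfRecord₁₃ θ₀) K g j`, from: (H-U) `hρm`, (I19) `hint`,
[B11] solvability on the domains (`hsolν`), the critical configuration continuous ON `domAlt_{j+1}` (`hcrit`), `GF_j` and `A_j` continuous on `domAlt_j`, and NUMERICS (`0 < εreg`, [B7] ×2,
`0 < ε₂₉`, rider ×2, `(((d+2)L)²∕4)·B < α ≤ 1∕24`, `α < δ_N`, `157·α < L^{1−d}`, STRICT `B < ε₀`) — §1 at the support set `K₀ j = «loops ≤ α ∧ plaquettes ≤ B»` with dag-n09-w3 g6's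
`isClosed_loopLe_inter_plaqLe` ∕ `localSupportSet_subset_loopGuard` ∕ `localSupportSet_subset_domAlt` ∕ `hρK_betaInputOfRecord_of_hsolν_of_numerics`.
[cite: Balaban1987RG1, (0.13) p.254, (0.19) p.255, p.259, (2.3) p.265, (2.9) p.266, (2.10) p.267 and p.267; Balaban1985Averaging, Prop. 2 (53) p.26 and (19) p.21] -/
theorem regularOn_domAlt_betaInputOfRecord_of_localSupportSet (T : Transport F N) {j : ℕ} (hj : j < K)
    (hεreg : 0 < θ₀.ν.εreg)
    (hε3 : (143 * (((((F.P K).d + 4 : ℕ) : ℝ)) ^ 2 / 4) ^ 2) * θ₀.ν.εreg ≤ 1 / 3)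
    (hε2 : 2 * θ₀.ν.εreg ≤ 2 * deltaSU (Fin N) / ((((F.P K).d + 4) * (F.P K).L : ℕ) : ℝ) ^ 2) (hε29 : 0 < θ₀.ε₂₉)
    (hn1 : 1640 * (2 * (((((F.P K).d + 2) * (F.P K).L : ℕ) : ℝ) * θ₀.ε₂₉) +
        ((((F.P K).d + 2) * (F.P K).L : ℕ) : ℝ) ^ 2 / 4 * (2 * θ₀.ν.εreg / ((F.P K).L : ℝ) ^ 2)) * (((F.P K).L : ℝ) ^ ((F.P K).d - 1)) ^ 2 ≤ 1)
    (hn2 : 13 * (2 * (((((F.P K).d + 2) * (F.P K).L : ℕ) : ℝ) * θ₀.ε₂₉) +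
        ((((F.P K).d + 2) * (F.P K).L : ℕ) : ℝ) ^ 2 / 4 * (2 * θ₀.ν.εreg / ((F.P K).L : ℝ) ^ 2)) * ((F.P K).L : ℝ) ^ ((F.P K).d - 1) < deltaSU (Fin N))
    {α : ℝ} (hαB : ((((F.P K).d + 2) * (F.P K).L : ℕ) : ℝ) ^ 2 / 4 *
      (2 * θ₀.ν.εreg / ((F.P K).L : ℝ) ^ 2 + 4 * max θ₀.ε₂₉ (10 * (((((F.P K).d + 2) * (F.P K).L : ℕ) : ℝ) * θ₀.ε₂₉) * ((F.P K).L : ℝ) ^ ((F.P K).d - 1))) < α)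
    (hα24 : α ≤ 1 / 24) (hαδ : α < deltaSU (Fin N)) (hαL : 157 * α < (((F.P K).L : ℝ) ^ ((F.P K).d - 1))⁻¹)
    (hord : 2 * θ₀.ν.εreg / ((F.P K).L : ℝ) ^ 2 +
      4 * max θ₀.ε₂₉ (10 * (((((F.P K).d + 2) * (F.P K).L : ℕ) : ℝ) * θ₀.ε₂₉) * ((F.P K).L : ℝ) ^ ((F.P K).d - 1)) < θ₀.ν.ε₀)
    (hρm : Measurable (betaInputOfRecord F N T (chiβOfRecord₁₃ F N θ₀) K g j))
    (hint : Integrable (betaInputOfRecord F N T (chiβOfRecord₁₃ F N θ₀) K g j) (fieldMeasure (F.P K) j (SU N)))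
    (hsolν : ∀ j < K, ∀ W ∈ domAltOfRecord F N θ₀.ν K (j + 1), UkExists F N K (j + 1) θ₀.ν.εreg W)
    (hcrit : ContinuousOn (critCfgOfRecord F N θ₀.ν K j) (domAltOfRecord F N θ₀.ν K (j + 1)))
    (hGF : ContinuousOn (gfOfRecord F N K j) (domAltOfRecord F N θ₀.ν K j))
    (hA : ContinuousOn (effActionHT F N T (chiβOfRecord₁₃ F N θ₀) K g j) (domAltOfRecord F N θ₀.ν K j)) :
    domAltOfRecord F N θ₀.ν K (j + 1) ⊆ regSetOfRecord F N K j (betaInputOfRecord F N T (chiβOfRecord₁₃ F N θ₀) K g j) ∧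
      HasContTransportOn F N K j (betaInputOfRecord F N T (chiβOfRecord₁₃ F N θ₀) K g j) (domAltOfRecord F N θ₀.ν K (j + 1)) :=
  domAlt_subset_regSetOfRecord_betaInput_chi29_of_loopSmall_local θ₀.ν θ₀.ν hj hα24 hαδ hαL hε29.ne' T g hρm hint
    (isClosed_loopLe_inter_plaqLe _ _) (isOpen_domAltOfRecord θ₀.ν K j) (localSupportSet_subset_domAlt θ₀ K j hord)
    (localSupportSet_subset_loopGuard (F := F) (N := N) K j)
    (hρK_betaInputOfRecord_of_hsolν_of_numerics θ₀ K g T hεreg hε3 hε2 hε29.le hn1 hn2 hαB hsolν j hj) hcrit hGF hA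

end Letters

/-! ## §3 At the Stage-13 record of a run `P` (`TβOfRecord₁₃ = TcanOfRecord`, `gOfRecord₁₃ θ P`): the doors' binder `hreg` for every step, the on-domain proviso, continuity -/

section Record

variable (θ : Stage13Params F N) (P : B12.RunParams)

/-- ★★★ **THE N09 DOORS' ANALYTIC-INCLUSION BINDER `hreg` ON THE LOCAL ROUTE, EVERY SUPPORT BINDER SUPPLIED**: `∀ j < P.K, domAltOfRecord θ.ν P.K (j+1) ⊆ regSetOfRecord F N P.K j ρ_j`
— VERBATIM the binder of dag-n09-w4 g3's `…N09B0RiderAtRecord` ∕ this seat's `…N09HregOfLocalFacesAtRecord` doors — from (H-U) `hρm`, (I19) `hint`, `hsolν`, the critical configurations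
continuous ON the next domains, `GF_j`∕`A_j` continuous on `domAlt_j` (the tower — INTENT-6 removes `hA` by induction), and numerics.
[cite: Balaban1987RG1, p.259, (2.9) p.266, (2.10) p.267 and (0.13) p.254] -/
theorem hreg_of_localSupportSet (hεreg : 0 < θ.ν.εreg)
    (hε3 : (143 * (((((F.P P.K).d + 4 : ℕ) : ℝ)) ^ 2 / 4) ^ 2) * θ.ν.εreg ≤ 1 / 3)
    (hε2 : 2 * θ.ν.εreg ≤ 2 * deltaSU (Fin N) / ((((F.P P.K).d + 4) * (F.P P.K).L : ℕ) : ℝ) ^ 2) (hε29 : 0 < θ.ε₂₉)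
    (hn1 : 1640 * (2 * (((((F.P P.K).d + 2) * (F.P P.K).L : ℕ) : ℝ) * θ.ε₂₉) +
        ((((F.P P.K).d + 2) * (F.P P.K).L : ℕ) : ℝ) ^ 2 / 4 * (2 * θ.ν.εreg / ((F.P P.K).L : ℝ) ^ 2)) * (((F.P P.K).L : ℝ) ^ ((F.P P.K).d - 1)) ^ 2 ≤ 1)
    (hn2 : 13 * (2 * (((((F.P P.K).d + 2) * (F.P P.K).L : ℕ) : ℝ) * θ.ε₂₉) +
        ((((F.P P.K).d + 2) * (F.P P.K).L : ℕ) : ℝ) ^ 2 / 4 * (2 * θ.ν.εreg / ((F.P P.K).L : ℝ) ^ 2)) * ((F.P P.K).L : ℝ) ^ ((F.P P.K).d - 1) < deltaSU (Fin N))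
    {α : ℝ} (hαB : ((((F.P P.K).d + 2) * (F.P P.K).L : ℕ) : ℝ) ^ 2 / 4 *
      (2 * θ.ν.εreg / ((F.P P.K).L : ℝ) ^ 2 + 4 * max θ.ε₂₉ (10 * (((((F.P P.K).d + 2) * (F.P P.K).L : ℕ) : ℝ) * θ.ε₂₉) * ((F.P P.K).L : ℝ) ^ ((F.P P.K).d - 1))) < α)
    (hα24 : α ≤ 1 / 24) (hαδ : α < deltaSU (Fin N)) (hαL : 157 * α < (((F.P P.K).L : ℝ) ^ ((F.P P.K).d - 1))⁻¹)
    (hord : 2 * θ.ν.εreg / ((F.P P.K).L : ℝ) ^ 2 +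
      4 * max θ.ε₂₉ (10 * (((((F.P P.K).d + 2) * (F.P P.K).L : ℕ) : ℝ) * θ.ε₂₉) * ((F.P P.K).L : ℝ) ^ ((F.P P.K).d - 1)) < θ.ν.ε₀)
    (hρm : ∀ j < P.K, Measurable (betaInputOfRecord F N (TβOfRecord₁₃ F N) (chiβOfRecord₁₃ F N θ) P.K (gOfRecord₁₃ F N θ P) j))
    (hint : ∀ j < P.K, Integrable (betaInputOfRecord F N (TβOfRecord₁₃ F N) (chiβOfRecord₁₃ F N θ) P.K (gOfRecord₁₃ F N θ P) j) (fieldMeasure (F.P P.K) j (SU N)))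
    (hsolν : ∀ j < P.K, ∀ W ∈ domAltOfRecord F N θ.ν P.K (j + 1), UkExists F N P.K (j + 1) θ.ν.εreg W)
    (hcrit : ∀ j < P.K, ContinuousOn (critCfgOfRecord F N θ.ν P.K j) (domAltOfRecord F N θ.ν P.K (j + 1)))
    (hGF : ∀ j < P.K, ContinuousOn (gfOfRecord F N P.K j) (domAltOfRecord F N θ.ν P.K j))
    (hA : ∀ j < P.K, ContinuousOn (effActionHT F N (TβOfRecord₁₃ F N) (chiβOfRecord₁₃ F N θ) P.K (gOfRecord₁₃ F N θ P) j) (domAltOfRecord F N θ.ν P.K j)) :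
    ∀ j < P.K, domAltOfRecord F N θ.ν P.K (j + 1) ⊆
      regSetOfRecord F N P.K j (betaInputOfRecord F N (TβOfRecord₁₃ F N) (chiβOfRecord₁₃ F N θ) P.K (gOfRecord₁₃ F N θ P) j) :=
  fun j hj => (regularOn_domAlt_betaInputOfRecord_of_localSupportSet θ P.K (gOfRecord₁₃ F N θ P) (TβOfRecord₁₃ F N) hj hεreg hε3 hε2 hε29 hn1 hn2 hαB hα24 hαδ hαL
    hord (hρm j hj) (hint j hj) hsolν (hcrit j hj) (hGF j hj) (hA j hj)).1

/-- ★★ **THE ON-DOMAIN PROVISO `HasContTransportOn … ρ_j domAlt_{j+1}` FOR EVERY STEP** (the `contTOn` shape of K0e's FILE 1, on the local route), same displayed inputs.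
[cite: Balaban1987RG1, (0.13) p.254 and p.259] -/
theorem hasContTransportOn_domAlt_of_localSupportSet (hεreg : 0 < θ.ν.εreg)
    (hε3 : (143 * (((((F.P P.K).d + 4 : ℕ) : ℝ)) ^ 2 / 4) ^ 2) * θ.ν.εreg ≤ 1 / 3)
    (hε2 : 2 * θ.ν.εreg ≤ 2 * deltaSU (Fin N) / ((((F.P P.K).d + 4) * (F.P P.K).L : ℕ) : ℝ) ^ 2) (hε29 : 0 < θ.ε₂₉)
    (hn1 : 1640 * (2 * (((((F.P P.K).d + 2) * (F.P P.K).L : ℕ) : ℝ) * θ.ε₂₉) +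
        ((((F.P P.K).d + 2) * (F.P P.K).L : ℕ) : ℝ) ^ 2 / 4 * (2 * θ.ν.εreg / ((F.P P.K).L : ℝ) ^ 2)) * (((F.P P.K).L : ℝ) ^ ((F.P P.K).d - 1)) ^ 2 ≤ 1)
    (hn2 : 13 * (2 * (((((F.P P.K).d + 2) * (F.P P.K).L : ℕ) : ℝ) * θ.ε₂₉) +
        ((((F.P P.K).d + 2) * (F.P P.K).L : ℕ) : ℝ) ^ 2 / 4 * (2 * θ.ν.εreg / ((F.P P.K).L : ℝ) ^ 2)) * ((F.P P.K).L : ℝ) ^ ((F.P P.K).d - 1) < deltaSU (Fin N))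
    {α : ℝ} (hαB : ((((F.P P.K).d + 2) * (F.P P.K).L : ℕ) : ℝ) ^ 2 / 4 *
      (2 * θ.ν.εreg / ((F.P P.K).L : ℝ) ^ 2 + 4 * max θ.ε₂₉ (10 * (((((F.P P.K).d + 2) * (F.P P.K).L : ℕ) : ℝ) * θ.ε₂₉) * ((F.P P.K).L : ℝ) ^ ((F.P P.K).d - 1))) < α)
    (hα24 : α ≤ 1 / 24) (hαδ : α < deltaSU (Fin N)) (hαL : 157 * α < (((F.P P.K).L : ℝ) ^ ((F.P P.K).d - 1))⁻¹)
    (hord : 2 * θ.ν.εreg / ((F.P P.K).L : ℝ) ^ 2 +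
      4 * max θ.ε₂₉ (10 * (((((F.P P.K).d + 2) * (F.P P.K).L : ℕ) : ℝ) * θ.ε₂₉) * ((F.P P.K).L : ℝ) ^ ((F.P P.K).d - 1)) < θ.ν.ε₀)
    (hρm : ∀ j < P.K, Measurable (betaInputOfRecord F N (TβOfRecord₁₃ F N) (chiβOfRecord₁₃ F N θ) P.K (gOfRecord₁₃ F N θ P) j))
    (hint : ∀ j < P.K, Integrable (betaInputOfRecord F N (TβOfRecord₁₃ F N) (chiβOfRecord₁₃ F N θ) P.K (gOfRecord₁₃ F N θ P) j) (fieldMeasure (F.P P.K) j (SU N)))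
    (hsolν : ∀ j < P.K, ∀ W ∈ domAltOfRecord F N θ.ν P.K (j + 1), UkExists F N P.K (j + 1) θ.ν.εreg W)
    (hcrit : ∀ j < P.K, ContinuousOn (critCfgOfRecord F N θ.ν P.K j) (domAltOfRecord F N θ.ν P.K (j + 1)))
    (hGF : ∀ j < P.K, ContinuousOn (gfOfRecord F N P.K j) (domAltOfRecord F N θ.ν P.K j))
    (hA : ∀ j < P.K, ContinuousOn (effActionHT F N (TβOfRecord₁₃ F N) (chiβOfRecord₁₃ F N θ) P.K (gOfRecord₁₃ F N θ P) j) (domAltOfRecord F N θ.ν P.K j)) :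
    ∀ j < P.K, HasContTransportOn F N P.K j (betaInputOfRecord F N (TβOfRecord₁₃ F N) (chiβOfRecord₁₃ F N θ) P.K (gOfRecord₁₃ F N θ P) j)
      (domAltOfRecord F N θ.ν P.K (j + 1)) :=
  fun j hj => (regularOn_domAlt_betaInputOfRecord_of_localSupportSet θ P.K (gOfRecord₁₃ F N θ P) (TβOfRecord₁₃ F N) hj hεreg hε3 hε2 hε29 hn1 hn2 hαB hα24 hαδ hαL
    hord (hρm j hj) (hint j hj) hsolν (hcrit j hj) (hGF j hj) (hA j hj)).2

/-- ★★ **THE β-TRANSPORT OF RECORD OF EVERY `ρ_j` IS CONTINUOUS ON THE NEXT SMALL-FIELD DOMAIN**, same displayed inputs (K0e's `continuousOn_TcanOfRecord` restricted by `hreg`).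
[cite: Balaban1987RG1, (0.13) p.254 and (0.19) p.255] -/
theorem continuousOn_TβOfRecord₁₃_betaInput_domAlt_of_localSupportSet (hεreg : 0 < θ.ν.εreg)
    (hε3 : (143 * (((((F.P P.K).d + 4 : ℕ) : ℝ)) ^ 2 / 4) ^ 2) * θ.ν.εreg ≤ 1 / 3)
    (hε2 : 2 * θ.ν.εreg ≤ 2 * deltaSU (Fin N) / ((((F.P P.K).d + 4) * (F.P P.K).L : ℕ) : ℝ) ^ 2) (hε29 : 0 < θ.ε₂₉)
    (hn1 : 1640 * (2 * (((((F.P P.K).d + 2) * (F.P P.K).L : ℕ) : ℝ) * θ.ε₂₉) +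
        ((((F.P P.K).d + 2) * (F.P P.K).L : ℕ) : ℝ) ^ 2 / 4 * (2 * θ.ν.εreg / ((F.P P.K).L : ℝ) ^ 2)) * (((F.P P.K).L : ℝ) ^ ((F.P P.K).d - 1)) ^ 2 ≤ 1)
    (hn2 : 13 * (2 * (((((F.P P.K).d + 2) * (F.P P.K).L : ℕ) : ℝ) * θ.ε₂₉) +
        ((((F.P P.K).d + 2) * (F.P P.K).L : ℕ) : ℝ) ^ 2 / 4 * (2 * θ.ν.εreg / ((F.P P.K).L : ℝ) ^ 2)) * ((F.P P.K).L : ℝ) ^ ((F.P P.K).d - 1) < deltaSU (Fin N))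
    {α : ℝ} (hαB : ((((F.P P.K).d + 2) * (F.P P.K).L : ℕ) : ℝ) ^ 2 / 4 *
      (2 * θ.ν.εreg / ((F.P P.K).L : ℝ) ^ 2 + 4 * max θ.ε₂₉ (10 * (((((F.P P.K).d + 2) * (F.P P.K).L : ℕ) : ℝ) * θ.ε₂₉) * ((F.P P.K).L : ℝ) ^ ((F.P P.K).d - 1))) < α)
    (hα24 : α ≤ 1 / 24) (hαδ : α < deltaSU (Fin N)) (hαL : 157 * α < (((F.P P.K).L : ℝ) ^ ((F.P P.K).d - 1))⁻¹)
    (hord : 2 * θ.ν.εreg / ((F.P P.K).L : ℝ) ^ 2 +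
      4 * max θ.ε₂₉ (10 * (((((F.P P.K).d + 2) * (F.P P.K).L : ℕ) : ℝ) * θ.ε₂₉) * ((F.P P.K).L : ℝ) ^ ((F.P P.K).d - 1)) < θ.ν.ε₀)
    (hρm : ∀ j < P.K, Measurable (betaInputOfRecord F N (TβOfRecord₁₃ F N) (chiβOfRecord₁₃ F N θ) P.K (gOfRecord₁₃ F N θ P) j))
    (hint : ∀ j < P.K, Integrable (betaInputOfRecord F N (TβOfRecord₁₃ F N) (chiβOfRecord₁₃ F N θ) P.K (gOfRecord₁₃ F N θ P) j) (fieldMeasure (F.P P.K) j (SU N)))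
    (hsolν : ∀ j < P.K, ∀ W ∈ domAltOfRecord F N θ.ν P.K (j + 1), UkExists F N P.K (j + 1) θ.ν.εreg W)
    (hcrit : ∀ j < P.K, ContinuousOn (critCfgOfRecord F N θ.ν P.K j) (domAltOfRecord F N θ.ν P.K (j + 1)))
    (hGF : ∀ j < P.K, ContinuousOn (gfOfRecord F N P.K j) (domAltOfRecord F N θ.ν P.K j))
    (hA : ∀ j < P.K, ContinuousOn (effActionHT F N (TβOfRecord₁₃ F N) (chiβOfRecord₁₃ F N θ) P.K (gOfRecord₁₃ F N θ P) j) (domAltOfRecord F N θ.ν P.K j)) :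
    ∀ j < P.K, ContinuousOn (fun V : PBond (F.P P.K) (j + 1) → SU N =>
        TβOfRecord₁₃ F N P.K j (betaInputOfRecord F N (TβOfRecord₁₃ F N) (chiβOfRecord₁₃ F N θ) P.K (gOfRecord₁₃ F N θ P) j) V)
      (domAltOfRecord F N θ.ν P.K (j + 1)) :=
  fun j hj => (continuousOn_TcanOfRecord P.K j _).mono
    (hreg_of_localSupportSet θ P hεreg hε3 hε2 hε29 hn1 hn2 hαB hα24 hαδ hαL hord hρm hint hsolν hcrit hGF hA j hj)

end Record

end Summit.QuantumFields.YangMills.BalabanUVNodes.N09HregOfLoopSmallChi29AtRecord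

end
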